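import Summits.CriticalPhenomena.CardyFormulaZ2.Theses.CardyMeckeFlip
import Literature.Probability.Percolation.FlipFairKernel

/-!
# Restatement candidate K2-R1 for crux `MeckeRigidity` (stmt-CriticalPhenomena-14826) — lead c4 evidence, NOT a tree file

Four leads (c1–c4) and two refuters (rattack-14452-0, rattack-13855-0, 2026-08-15) concur that the typed crux
`Summit.CriticalPhenomena.CardyFormulaZ2.Theses.CardyMeckeFlip.MeckeRigidity` is conjecturally FALSE as typed because its
kernel family `M` is ∀-quantified under (ADM) only: the flip identity (F) is then a coboundary condition, and a self-dual
critical FK(q) quad-crossing limit (1 < q ≤ 4) with the `q^{±1/4}`-TILTED pivotal kernel would be a second,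
non-Cardy model of all six clauses.  The repair R1 ("pin `M` to the canonical EQUAL-WEIGHT ε-pivotal kernel") is typed
here in tree vocabulary, as the extra kernel clause (CAN) = `IsPivotalContentKernel`:

  (CAN)  for P-a.e. S and every cutoff ε > 0, `M ε S` is the limit, along a deterministic sequence of radii `r k → 0`
         with deterministic normalisers `c k > 0`, of `c k ·` Lebesgue measure restricted to the `r k`-thickening of
         the ε-PIVOTAL SET `{x | ∃ Q, ε ≤ diam [Q] ∧ S.IsPivotalAt x Q}` (vague convergence, tested on `C_c(ℂ)`).

That is: `M ε S` is (a scalar multiple of) the MINKOWSKI-CONTENT measure of the ε-pivotal set — state-blind by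
construction (open- and closed-pivotal points enter through the SET only), so a tilted kernel `content × q^{σ(x)/4}`
violates (CAN), while for the site-𝕋 / CLE₆ limit the Garban–Pete–Schramm pivotal measure IS the 3/4-dimensional
Minkowski content of the continuum pivotal set [Holden–Li–Sun, AIHP 2022, arXiv:1804.07286, Prop. 1.9 + Thm 1.10,
content via areas of r-neighbourhoods, Def. 1.1–1.2; `c k = c · (r k)^{3/4-2}`], (F) is GPS18 Thm 89 (reversibility)
and (EXT) is now PUBLISHED: Garban–Holden–Sepúlveda–Sun, arXiv:1905.06940 (PTRF), Thm 1.4 (i) + Remark 1.5 — MIXING of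
the γ = 0 continuum dynamical percolation, answering GPS18 Remark 101 (§12.1).  With (CAN) the flip identity regains its
fair-coin content: for the UNtilted (content) kernel the lattice FK(q) flip defect vanishes iff q = 1 (refuter
certificates flipcheck.py / fk_flip_check.py on this item).

`MeckeRigidityCanonical` below is `MeckeRigidity` with the named clauses of `FlipFairKernel.lean` and the ONE extra
hypothesis (CAN); `meckeRigidityCanonical_of_meckeRigidity` certifies that it is WEAKER than the typed crux, so every
support file landed by c1–c3 (sum rule, continuity, Campbell intensity, flip calculus, ergodicity, dichotomy, similarity
covariance, scale trichotomy — 25 files, all `--supports stmt-CriticalPhenomena-14826`) applies to it verbatim, and the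
registered skeleton `Lines/birth.lean` transfers by adding (CAN) to the hypotheses of its two uniqueness stubs.
`FlipErgodicityZ2Canonical` (K3-R1) and `sublimitsCardy_of_canonical` show that the route's glue keeps its shape.
The companion restatements of K1/K3 (FlipIdentityZ2 / FlipErgodicityZ2 must then PRODUCE a (CAN) kernel for ℤ²
sublimits: subsequential Minkowski-type content of the ε-pivotal set jointly with the configuration — GPS13 §1 p.10
level, exponent-free because `c k` is existential) are the planner's to file; this file files nothing.
-/

noncomputable section

open MeasureTheory Set Filter Topology
open Literature.Probability.Percolation Literature.Probability.Percolation.QuadCrossing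

namespace Summit.CriticalPhenomena.CardyFormulaZ2.Cruxes.MeckeRigidity.Restated

/-- The **ε-pivotal set** of a configuration `S ∈ ℋ_ℂ`: the points pivotal — open- or closed-pivotal, indifferently —
for some quad of diameter at least `ε` (the state-blind set whose Minkowski content is the canonical kernel).
[cite: GarbanPeteSchramm2013Pivotal, §1.1 (ε-important points)] -/
def pivotalSetAtScale (S : QuadConfig (univ : Set ℂ)) (ε : ℝ) : Set ℂ :=
  {x | ∃ Q : Quad (univ : Set ℂ), ε ≤ Metric.diam Q.carrier ∧ S.IsPivotalAt x Q}

/-- **(CAN) — canonical equal-weight (Minkowski-content) pivotal kernel**: along deterministic radii `r k → 0` with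
deterministic normalisers `c k > 0`, for `P`-a.e. configuration `S` and every cutoff `ε > 0`, the measures
`c k · Leb|_{(ε-pivotal set)^{r k}}` converge vaguely to `M ε S`.  For the CLE₆ quad-crossing law this is the
Holden–Li–Sun identification of the Garban–Pete–Schramm pivotal measure with the `3/4`-dimensional Minkowski content
(`c k = c · (r k) ^ (3/4 - 2)`); the normalisers are existential so that no arm exponent is presupposed (ℤ²
sublimits). [cite: arXiv:1804.07286, Prop. 1.9 and Thm 1.10; GarbanPeteSchramm2013Pivotal, Thm 1.1] -/
def IsPivotalContentKernel (P : Measure (QuadConfig (univ : Set ℂ)))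
    (M : ℝ → QuadConfig (univ : Set ℂ) → Measure ℂ) : Prop :=
  ∃ (r c : ℕ → ℝ), (∀ k, 0 < r k) ∧ (∀ k, 0 < c k) ∧ Tendsto r atTop (𝓝 0) ∧
    ∀ ε : ℝ, 0 < ε → ∀ᵐ S ∂P, ∀ φ : ℂ → ℝ, Continuous φ → HasCompactSupport φ →
      Tendsto (fun k => c k * ∫ x in Metric.thickening (r k) (pivotalSetAtScale S ε), φ x)
        atTop (𝓝 (∫ x, φ x ∂(M ε S)))

/-- **K2-R1 `MeckeRigidityCanonical`** — MECKE RIGIDITY FOR THE CANONICAL KERNEL: a probability law `P` on `ℋ_ℂ`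
with (E2) isometry invariance, (D) exact self-duality on crossing cylinders, (RSW) the 3:1 lower bound, carrying a
kernel family `M` that is admissible and isometry-equivariant (ADM), CANONICAL in the sense of (CAN)
(`IsPivotalContentKernel`), flip-fair at every cutoff (F) and for which `P` is flip-extremal (EXT), gives every quad
of a conformal rectangle its Cardy value.  (= the typed crux `MeckeRigidity` with `Piv` read as `IsPivotalAt`, the
clauses named as in `FlipFairKernel.lean`, and the single extra hypothesis (CAN).) [cite: GarbanPeteSchramm2018, Thm 89 and Remark 101; arXiv:1905.06940, Thm 1.4 (i); arXiv:1804.07286, Thm 1.10] -/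
def MeckeRigidityCanonical : Prop :=
  ∀ (P : Measure (QuadConfig (univ : Set ℂ))) (M : ℝ → QuadConfig (univ : Set ℂ) → Measure ℂ),
    IsProbabilityMeasure P →
    (∀ g : ℂ ≃ᵢ ℂ, Measure.map (QuadConfig.isometry g) P = P) →
    (∀ (n : ℕ) (Q Qt : Fin n → Quad (univ : Set ℂ)),
      (∀ i, (Qt i).carrier = (Q i).carrier ∧ (Qt i).side 0 = (Q i).side 1 ∧
        (Qt i).side 1 = (Q i).side 2 ∧ (Qt i).side 2 = (Q i).side 3 ∧ (Qt i).side 3 = (Q i).side 0) →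
      ∀ A : Set (Set (Fin n)), P {S | {i | Q i ∈ S} ∈ A} = P {S | {i | Qt i ∉ S} ∈ A}) →
    ∀ c : ℝ, 0 < c →
    (∀ (a x y : ℝ), 0 < a → ∀ Q : Quad (univ : Set ℂ),
      Q.carrier = {w : ℂ | x ≤ w.re ∧ w.re ≤ x + 3 * a ∧ y ≤ w.im ∧ w.im ≤ y + a} →
      Q.side 0 = {w : ℂ | w.re = x ∧ y ≤ w.im ∧ w.im ≤ y + a} →
      Q.side 2 = {w : ℂ | w.re = x + 3 * a ∧ y ≤ w.im ∧ w.im ≤ y + a} →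
        c ≤ P.real (QuadConfig.crossedEvent Q)) →
    IsAdmissibleKernel P M → IsIsometryEquivariant M → IsPivotalContentKernel P M →
    (∀ ε : ℝ, 0 < ε → IsFlipFairKernel P (M ε)) → IsFlipExtremal P M →
    ∀ (R : Literature.Probability.RandomPlanarGeometry.ConformalRectangle)
      (φ : Literature.Probability.RandomPlanarGeometry.ConformalEquiv UpperHalfPlane.upperHalfPlaneSet R.carrier)
      (x : Fin 4 → ℝ), R.IsUniformizing φ x → ∀ Q : Quad (univ : Set ℂ),
        Q.carrier = closure R.carrier → Q.side 0 = R.arc 0 → Q.side 1 = R.arc 1 → Q.side 2 = R.arc 2 →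
        Q.side 3 = R.arc 3 →
          P.real (QuadConfig.crossedEvent Q) =
            Literature.Probability.RandomPlanarGeometry.cardyFunction
              (Literature.Probability.RandomPlanarGeometry.crossRatio x)

/-- **K2-R1 is weaker than the typed crux**: `MeckeRigidity → MeckeRigidityCanonical` (instantiate the characterised
parameter `Piv` at `IsPivotalAt` by `Iff.rfl`, unbundle the named clauses, drop (CAN)).  Hence every `--supports`
file of the typed crux serves K2-R1 verbatim. [folklore] -/
theorem meckeRigidityCanonical_of_meckeRigidity
    (h : Summit.CriticalPhenomena.CardyFormulaZ2.Theses.CardyMeckeFlip.MeckeRigidity) :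
    MeckeRigidityCanonical := by
  intro P M hprob hE2 hD c hc hRSW hADM hEqv _hCAN hF hEXT R φ x hφx Q hQc h0 h1 h2 h3
  have hAE := (isAdmissibleKernel_and_isIsometryEquivariant_iff P M).1 ⟨hADM, hEqv⟩
  exact h _ (fun _ _ _ => Iff.rfl) P M hprob hE2 hD c hc hRSW hAE hF hEXT R φ x hφx Q hQc h0 h1 h2 h3

/-- **K3-R1 `FlipErgodicityZ2Canonical`** — the companion restatement of crux `FlipErgodicityZ2` (stmt-CriticalPhenomena-14825)
that a route using K2-R1 must file: every ℤ² subsequential quad-crossing limit carries an admissible, isometry-equivariant,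
CANONICAL ((CAN), `IsPivotalContentKernel`) kernel family, flip-fair at every cutoff, for which it is flip-extremal.  (Intended
witness: subsequential Minkowski-type content of the ε-pivotal set jointly with the configuration — GPS13 §1 p.10 level; the
normalisers `c k` are existential, so no ℤ² arm exponent is presupposed.) [cite: GarbanPeteSchramm2013Pivotal, §1 p. 10 and Thm 1.1; arXiv:1804.07286, Thm 1.10; arXiv:1905.06940, Thm 1.4 (i)] -/
def FlipErgodicityZ2Canonical : Prop :=
  ∀ μ : FiniteMeasure (QuadConfig (univ : Set ℂ)), μ ∈ subseqQuadLimits (univ : Set ℂ) →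
    ∃ M : ℝ → QuadConfig (univ : Set ℂ) → Measure ℂ,
      IsAdmissibleKernel (μ : Measure (QuadConfig (univ : Set ℂ))) M ∧ IsIsometryEquivariant M ∧
      IsPivotalContentKernel (μ : Measure (QuadConfig (univ : Set ℂ))) M ∧
      (∀ ε : ℝ, 0 < ε → IsFlipFairKernel (μ : Measure (QuadConfig (univ : Set ℂ))) (M ε)) ∧
      IsFlipExtremal (μ : Measure (QuadConfig (univ : Set ℂ))) M

/-- **The restated glue chains**: `MeckeRigidityCanonical → FlipErgodicityZ2Canonical → Z2LimitsSymmetric → SublimitsCardy`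
(the analogue of the route's `CruxesToSublimitsCardy` / first `have` of `closes`, with K2-R1 and K3-R1 in place of K2 and K3;
`Z2LimitsSymmetric` and the target `SublimitsCardy` are the route's, unchanged).  So a route restated along R1 keeps its
deciding theorem's shape. [folklore] -/
theorem sublimitsCardy_of_canonical (hK2 : MeckeRigidityCanonical) (hK3 : FlipErgodicityZ2Canonical)
    (hS : Summit.CriticalPhenomena.CardyFormulaZ2.Theses.CardyMeckeFlip.Z2LimitsSymmetric) :
    Summit.CriticalPhenomena.CardyFormulaZ2.Theses.CardyMeckeFlip.SublimitsCardy := by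
  intro μ hμ R φ x hφx Q hQc h0 h1 h2 h3
  obtain ⟨hprob, hsym, hdual, c, hc, hrsw⟩ := hS μ hμ
  obtain ⟨M, hADM, hEqv, hCAN, hF, hEXT⟩ := hK3 μ hμ
  exact hK2 _ M hprob hsym hdual c hc hrsw hADM hEqv hCAN hF hEXT R φ x hφx Q hQc h0 h1 h2 h3

end Summit.CriticalPhenomena.CardyFormulaZ2.Cruxes.MeckeRigidity.Restated

end
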